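import Mathlib
import Summits.Schanuel.Schanuel.Theses.TwistedConjugacy

/-!
# Crux `TwistedSymmetry` (stmt-Schanuel-17222) — forced values of a witness, no tame witness,
# admissible twists exist (refuter crux-attack, negative/structural lemmas)

Route `TwistedConjugacy`, crux `TwistedSymmetry`:
`∃ μ algebraic, ‖μ‖ = 1, μ not a root of unity, ∃ σ : ℂ →+* ℂ fixing every algebraic number with
σ (exp z) = exp (μ * σ z)`.  Nothing here asserts a Theses decl positively.  Contents:

* §1 `twist_log_scaling`: for any such `(μ, σ)` and any `ℓ` with `exp ℓ` algebraic, `μ * σ ℓ = ℓ`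
  (σ acts on ALL logarithms of algebraic numbers as the scalar `μ⁻¹`; the `2πiℤ`-ambiguity is
  divisible by every `N` because every `exp (ℓ/N)` is algebraic, hence vanishes).  Forced values:
  `μ * σ (2πi) = 2πi`, `μ * σ π = π`, `σ (exp π) = exp π` (Gel'fond's constant is FIXED), `σ e = e^μ`,
  and `σ` fixes every `exp (a * ℓ)` with `a` algebraic (every determination of `α^β`).  These are the
  first lines of the paper proofs of the route's supports `TwistImpliesEPi`, `TwistImpliesLogHomogeneity`.
* §2 degenerate witnesses are excluded: `σ ≠ id`, `σ ≠ conj`, `σ` is discontinuous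
  (`Complex.ringHom_eq_id_or_conj_of_continuous`); packaged as the NEGATIVE LEMMA
  `not_twistedSymmetry_continuous` — the natural "tame" strengthening of the crux is false, any
  witness is wild (this is the char-0 obstruction the route names: no continuous twisting map).
* §3 mutation: dropping the root-of-unity clause makes the statement trivially true (`μ = 1`,
  `σ = id`), and every witness of the crux has `μ ≠ 1`, `σ ≠ id`.
* §4 the side conditions on `μ` are jointly satisfiable: `μ₀ = (3 + 4i)/5` is algebraic, has norm 1
  and is not a root of unity (`(3+4i)^n = 5^n` reduced under `ℤ[i] → 𝔽₅, i ↦ 2` gives `1 = 0`).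

## References

* L. Denis, *Indépendance algébrique de différents π*, Acta Arith. 69 (1995) — the char-p symmetry.
* J. Kirby, A. Macintyre, A. Onshuus, *The algebraic numbers definable in various exponential
  fields*, J. Inst. Math. Jussieu 11 (2012), §2 (forced values on `ℚ^{ab}` from the kernel).
* M. B. Nathanson, *Exponential automorphisms and a problem of Mycielski*, arXiv:2209.01027 (2022)
  (even untwisted wild exponential automorphisms of `ℂ` are an open problem; continuous ones are `id`, `conj`).
-/

noncomputable section

set_option linter.dupNamespace false

namespace Summit.Schanuel.Schanuel.Theorems.TwistedSymmetry.Negative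

open Complex

section

variable {μ : ℂ} {σ : ℂ →+* ℂ}

/-! ## §1 Forced values -/

/-- A complex number lying in `N • (2πiℤ)` for every positive integer `N` is zero. [folklore] -/
lemma eq_zero_of_forall_int_multiple (w : ℂ)
    (h : ∀ N : ℕ, 0 < N → ∃ k : ℤ, w = (N : ℂ) * (k : ℂ) * (2 * Real.pi * I)) : w = 0 := by
  have h2pi : (2 * (Real.pi : ℂ) * I) ≠ 0 := by
    simp [Real.pi_ne_zero, I_ne_zero]
  obtain ⟨k₁, hk₁⟩ := h 1 one_pos
  have step : ∀ N : ℕ, 0 < N → ∃ k : ℤ, k₁ = N * k := by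
    intro N hN
    obtain ⟨k, hk⟩ := h N hN
    refine ⟨k, ?_⟩
    have hkk : (k₁ : ℂ) = (N : ℂ) * (k : ℂ) := by
      apply mul_right_cancel₀ h2pi
      have := hk₁.symm.trans hk
      simpa using this
    exact_mod_cast hkk
  obtain ⟨k, hk⟩ := step (k₁.natAbs + 1) (Nat.succ_pos _)
  have habs : k₁.natAbs = (k₁.natAbs + 1) * k.natAbs := by
    have := congrArg Int.natAbs hk
    rwa [Int.natAbs_mul, Int.natAbs_natCast] at this
  by_cases hk0 : k = 0
  · subst hk0
    simp only [mul_zero] at hk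
    subst hk
    simpa using hk₁
  · exfalso
    have hkpos : 1 ≤ k.natAbs := Int.natAbs_pos.2 hk0
    have h1 : k₁.natAbs + 1 ≤ (k₁.natAbs + 1) * k.natAbs := by
      simpa using Nat.mul_le_mul_left (k₁.natAbs + 1) hkpos
    generalize (k₁.natAbs + 1) * k.natAbs = P at habs h1
    omega

/-- **Log scaling.** If `σ` fixes algebraic numbers and `σ (exp z) = exp (μ * σ z)`, then for every
logarithm `ℓ` of an algebraic number, `μ * σ ℓ = ℓ`. [folklore] -/
theorem twist_log_scaling (hfix : ∀ a : ℂ, IsAlgebraic ℚ a → σ a = a)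
    (htw : ∀ z : ℂ, σ (exp z) = exp (μ * σ z)) (ℓ : ℂ) (hℓ : IsAlgebraic ℚ (exp ℓ)) :
    μ * σ ℓ = ℓ := by
  have key : μ * σ ℓ - ℓ = 0 := by
    refine eq_zero_of_forall_int_multiple _ (fun N hN => ?_)
    have hN' : (N : ℂ) ≠ 0 := by exact_mod_cast hN.ne'
    -- exp (ℓ / N) is an N-th root of the algebraic number exp ℓ, hence algebraic
    have halg : IsAlgebraic ℚ (exp (ℓ / N)) := by
      refine IsAlgebraic.of_pow hN ?_
      rw [← Complex.exp_nat_mul, mul_div_cancel₀ _ hN']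
      exact hℓ
    have h1 : σ (exp (ℓ / N)) = exp (ℓ / N) := hfix _ halg
    have h2 : σ (exp (ℓ / N)) = exp (μ * σ ℓ / N) := by
      rw [htw, map_div₀, map_natCast, mul_div_assoc]
    obtain ⟨k, hk⟩ := Complex.exp_eq_exp_iff_exists_int.1 (h2.symm.trans h1)
    refine ⟨k, ?_⟩
    have := congrArg (fun t => (N : ℂ) * t) hk
    simp only [mul_add] at this
    rw [mul_div_cancel₀ _ hN', mul_div_cancel₀ _ hN'] at this
    linear_combination this
  exact sub_eq_zero.1 key

/-- Forced value on the kernel generator: `μ * σ (2πi) = 2πi`. [cite: KirbyMacintyreOnshuus2012, §2] -/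
theorem twist_two_pi_I (hfix : ∀ a : ℂ, IsAlgebraic ℚ a → σ a = a)
    (htw : ∀ z : ℂ, σ (exp z) = exp (μ * σ z)) :
    μ * σ (2 * Real.pi * I) = 2 * Real.pi * I :=
  twist_log_scaling hfix htw _ (by rw [Complex.exp_two_pi_mul_I]; exact isAlgebraic_one)

/-- Forced value `μ * σ π = π` (so `σ π = π / μ`). [folklore] -/
theorem twist_pi (hfix : ∀ a : ℂ, IsAlgebraic ℚ a → σ a = a)
    (htw : ∀ z : ℂ, σ (exp z) = exp (μ * σ z)) :
    μ * σ (Real.pi : ℂ) = Real.pi := by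
  have h := twist_two_pi_I hfix htw
  rw [map_mul, map_mul, hfix I Complex.isIntegral_rat_I.isAlgebraic, map_ofNat] at h
  have h2I : (2 : ℂ) * I ≠ 0 := by simp [I_ne_zero]
  have : (μ * σ (Real.pi : ℂ)) * (2 * I) = (Real.pi : ℂ) * (2 * I) := by
    linear_combination h
  exact mul_right_cancel₀ h2I this

/-- Gel'fond's constant `e^π` is fixed by every witness. [folklore] -/
theorem twist_fixes_exp_pi (hfix : ∀ a : ℂ, IsAlgebraic ℚ a → σ a = a)
    (htw : ∀ z : ℂ, σ (exp z) = exp (μ * σ z)) :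
    σ (exp Real.pi) = exp Real.pi := by
  rw [htw, twist_pi hfix htw]

/-- More generally every `exp (a * ℓ)` with `a` algebraic and `exp ℓ` algebraic (every determination of
`α^β`) is fixed by `σ`. [folklore] -/
theorem twist_fixes_exp_alg_mul_log (hfix : ∀ a : ℂ, IsAlgebraic ℚ a → σ a = a)
    (htw : ∀ z : ℂ, σ (exp z) = exp (μ * σ z)) (a ℓ : ℂ) (ha : IsAlgebraic ℚ a)
    (hℓ : IsAlgebraic ℚ (exp ℓ)) : σ (exp (a * ℓ)) = exp (a * ℓ) := by
  rw [htw, map_mul, hfix a ha, mul_left_comm, twist_log_scaling hfix htw ℓ hℓ]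

/-- `σ e = e^μ`. [folklore] -/
theorem twist_exp_one (htw : ∀ z : ℂ, σ (exp z) = exp (μ * σ z)) : σ (exp 1) = exp μ := by
  rw [htw, map_one, mul_one]

/-! ## §2 No tame witness -/

/-- With `μ ≠ 1` the identity is not a witness. [folklore] -/
theorem twist_ne_id (hμ : μ ≠ 1) (hfix : ∀ a : ℂ, IsAlgebraic ℚ a → σ a = a)
    (htw : ∀ z : ℂ, σ (exp z) = exp (μ * σ z)) : σ ≠ RingHom.id ℂ := by
  intro hid
  have h := twist_two_pi_I hfix htw
  rw [hid, RingHom.id_apply] at h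
  have h2pi : (2 * (Real.pi : ℂ) * I) ≠ 0 := by simp [Real.pi_ne_zero, I_ne_zero]
  exact hμ (by simpa using mul_right_cancel₀ h2pi (h.trans (one_mul _).symm))

/-- Complex conjugation is not a witness (it moves the algebraic number `I`). [folklore] -/
theorem twist_ne_conj (hfix : ∀ a : ℂ, IsAlgebraic ℚ a → σ a = a) : σ ≠ starRingEnd ℂ := by
  intro h
  have := hfix I Complex.isIntegral_rat_I.isAlgebraic
  rw [h, Complex.conj_I] at this
  exact I_ne_zero (by linear_combination (-1 : ℂ) / 2 * this)

/-- Every witness is discontinuous ("σ must be wild"). [folklore] -/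
theorem twist_not_continuous (hμ : μ ≠ 1) (hfix : ∀ a : ℂ, IsAlgebraic ℚ a → σ a = a)
    (htw : ∀ z : ℂ, σ (exp z) = exp (μ * σ z)) : ¬ Continuous σ := by
  intro hc
  rcases Complex.ringHom_eq_id_or_conj_of_continuous hc with h | h
  · exact twist_ne_id hμ hfix htw h
  · exact twist_ne_conj hfix h

end

/-- NEGATIVE LEMMA (natural "tame" strengthening is false): there is no CONTINUOUS twisted symmetry. [folklore] -/
theorem not_twistedSymmetry_continuous :
    ¬ ∃ μ : ℂ, IsAlgebraic ℚ μ ∧ ‖μ‖ = 1 ∧ (∀ n : ℕ, 0 < n → μ ^ n ≠ 1) ∧ ∃ σ : ℂ →+* ℂ,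
      Continuous σ ∧ (∀ a : ℂ, IsAlgebraic ℚ a → σ a = a) ∧
        ∀ z : ℂ, σ (Complex.exp z) = Complex.exp (μ * σ z) := by
  rintro ⟨μ, -, -, hroot, σ, hc, hfix, htw⟩
  have hμ : μ ≠ 1 := fun h => hroot 1 one_pos (by simp [h])
  exact twist_not_continuous hμ hfix htw hc

/-- The witness data of `TwistedSymmetry` forces all the values above (packaged against the route decl). [folklore] -/
theorem forced_values_of_twistedSymmetry
    (h : Summit.Schanuel.Schanuel.Theses.TwistedConjugacy.TwistedSymmetry) :
    ∃ μ : ℂ, ∃ σ : ℂ →+* ℂ, μ ≠ 1 ∧ (∀ z : ℂ, σ (exp z) = exp (μ * σ z)) ∧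
      μ * σ (2 * Real.pi * I) = 2 * Real.pi * I ∧ μ * σ (Real.pi : ℂ) = Real.pi ∧
      σ (exp Real.pi) = exp Real.pi ∧ σ (exp 1) = exp μ ∧ ¬ Continuous σ ∧
      ∀ ℓ : ℂ, IsAlgebraic ℚ (exp ℓ) → μ * σ ℓ = ℓ := by
  obtain ⟨μ, -, -, hroot, σ, hfix, htw⟩ := h
  have hμ : μ ≠ 1 := fun h => hroot 1 one_pos (by simp [h])
  exact ⟨μ, σ, hμ, htw, twist_two_pi_I hfix htw, twist_pi hfix htw, twist_fixes_exp_pi hfix htw,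
    twist_exp_one htw, twist_not_continuous hμ hfix htw, twist_log_scaling hfix htw⟩


/-! ## §3 Mutation of the root-of-unity clause -/

/-- MUTATION: dropping the clause `∀ n > 0, μ ^ n ≠ 1` makes the statement trivially true
(`μ = 1`, `σ = id`); that clause (already its instance `n = 1`) is the only guard against the
degenerate witness. [folklore] -/
theorem twistedSymmetry_dropRootOfUnity_trivial :
    ∃ μ : ℂ, IsAlgebraic ℚ μ ∧ ‖μ‖ = 1 ∧ ∃ σ : ℂ →+* ℂ,
      (∀ a : ℂ, IsAlgebraic ℚ a → σ a = a) ∧ ∀ z : ℂ, σ (Complex.exp z) = Complex.exp (μ * σ z) :=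
  ⟨1, isAlgebraic_one, by simp, RingHom.id ℂ, fun _ _ => rfl, fun z => by simp⟩

/-- MUTATION: conversely every witness has `μ ≠ 1`, i.e. the degenerate parameter is excluded
exactly by the `n = 1` instance of the root-of-unity clause. [folklore] -/
theorem twistedSymmetry_mu_ne_one
    (h : Summit.Schanuel.Schanuel.Theses.TwistedConjugacy.TwistedSymmetry) :
    ∃ μ : ℂ, μ ≠ 1 ∧ IsAlgebraic ℚ μ ∧ ‖μ‖ = 1 ∧ ∃ σ : ℂ →+* ℂ, σ ≠ RingHom.id ℂ ∧
      (∀ a : ℂ, IsAlgebraic ℚ a → σ a = a) ∧ ∀ z : ℂ, σ (exp z) = exp (μ * σ z) := by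
  obtain ⟨μ, halg, hnorm, hroot, σ, hfix, htw⟩ := h
  have hμ : μ ≠ 1 := fun h => hroot 1 one_pos (by simp [h])
  exact ⟨μ, hμ, halg, hnorm, σ, twist_ne_id hμ hfix htw, hfix, htw⟩


/-! ## §4 Admissible twists exist: `μ₀ = (3 + 4i)/5 = (2+i)/(2-i)` -/


/-- `(3+4i)/5` is algebraic. [folklore] -/
lemma μ₀_isAlgebraic : IsAlgebraic ℚ ((3 + 4 * I) / 5 : ℂ) := by
  have h1 : IsAlgebraic ℚ (((3 / 5 : ℚ)) : ℂ) := by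
    rw [← map_ratCast (algebraMap ℚ ℂ), Rat.cast_id]; exact isAlgebraic_algebraMap _
  have h2 : IsAlgebraic ℚ (((4 / 5 : ℚ)) : ℂ) := by
    rw [← map_ratCast (algebraMap ℚ ℂ), Rat.cast_id]; exact isAlgebraic_algebraMap _
  have h := h1.add (h2.mul Complex.isIntegral_rat_I.isAlgebraic)
  have e : ((3 / 5 : ℚ) : ℂ) + ((4 / 5 : ℚ) : ℂ) * I = ((3 + 4 * I) / 5 : ℂ) := by
    push_cast; ring
  rwa [e] at h

/-- `‖(3+4i)/5‖ = 1`. [folklore] -/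
lemma norm_μ₀ : ‖((3 + 4 * I) / 5 : ℂ)‖ = 1 := by
  have h34 : ‖(3 : ℂ) + 4 * I‖ = 5 := by
    have hsq : ‖(3 : ℂ) + 4 * I‖ ^ 2 = 25 := by
      rw [Complex.sq_norm, Complex.normSq_apply]
      simp
      norm_num
    nlinarith [norm_nonneg ((3 : ℂ) + 4 * I)]
  have h5 : ‖(5 : ℂ)‖ = 5 := by simp
  rw [norm_div, h34, h5]
  norm_num

/-- `(3+4i)/5` is not a root of unity (reduce `(3+4i)^n = 5^n` under `ℤ[i] → 𝔽₅`, `i ↦ 2`). [folklore] -/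
lemma μ₀_pow_ne_one (n : ℕ) (hn : 0 < n) : ((3 + 4 * I) / 5 : ℂ) ^ n ≠ 1 := by
  intro h
  have h5 : ((5 : ℂ)) ^ n ≠ 0 := pow_ne_zero _ (by norm_num)
  have h' : ((3 : ℂ) + 4 * I) ^ n = (5 : ℂ) ^ n := by
    rw [div_pow, div_eq_one_iff_eq h5] at h
    exact h
  -- transport to the Gaussian integers
  have hxC : ((⟨3, 4⟩ : GaussianInt) : ℂ) = 3 + 4 * I := by
    rw [GaussianInt.toComplex_def']
    push_cast
    ring
  have hG : (⟨3, 4⟩ : GaussianInt) ^ n = (5 : GaussianInt) ^ n := by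
    apply GaussianInt.toComplex_injective
    rw [map_pow, map_pow, map_ofNat]
    rw [hxC, h']
  -- reduce under ℤ[i] → ZMod 5, i ↦ 2 (the prime 2 + i above 5)
  let φ : GaussianInt →+* ZMod 5 := Zsqrtd.lift ⟨2, by decide⟩
  have hφx : φ ⟨3, 4⟩ = 1 := by
    simp only [φ, Zsqrtd.lift_apply_apply]
    decide
  have hφ5 : φ 5 = 0 := by
    rw [map_ofNat]
    decide
  have := congrArg φ hG
  rw [map_pow, map_pow, hφx, hφ5, one_pow, zero_pow hn.ne'] at this
  exact absurd this (by decide)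

/-- The side conditions on `μ` in `TwistedSymmetry` are jointly satisfiable. [folklore] -/
theorem admissible_mu_exists :
    ∃ μ : ℂ, IsAlgebraic ℚ μ ∧ ‖μ‖ = 1 ∧ (∀ n : ℕ, 0 < n → μ ^ n ≠ 1) :=
  ⟨(3 + 4 * I) / 5, μ₀_isAlgebraic, norm_μ₀, μ₀_pow_ne_one⟩


end Summit.Schanuel.Schanuel.Theorems.TwistedSymmetry.Negative
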